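import Mathlib
import Literature.Analysis.FluidPDE.LerayL3ExistenceFromFiniteEnergy
import Literature.Analysis.FluidPDE.AxisymmetricNoSwirlGlobalHolds
import Literature.Analysis.FluidPDE.LerayLocalRegularH1Proofs
import Literature.Analysis.FluidPDE.ClassicalSuitable
import HarnessLib.Audit
import HarnessLib

/-!
# L3TimeExponentPincer — a swirl-free Tao-class solution extends to a GLOBAL classical solution which is a local Leray solution

Support kernel for the crux `L3CascadeJaw` (item stmt-NavierStokesRegularity-19499) of route
`L3TimeExponentPincer`; step P4b («global classical Leray–Hopf ⇒ local Leray») of the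
compactness reduction (J) `CritSmoothingNoSwirlB ⇐ (SFL³)` of planner nsreg-p2's ROUND-12 §2b.
The weak `L³` stability theorem **K₃** (`jia_sverak_leray_weak_stability_holds`) is stated for
GLOBAL-in-time local Leray solutions (Jia–Šverák's `𝒩(u₀)`, `IsLocalLeraySolution 1 u₀ v π`),
while step 0 of (J) produces Tao-class solutions on finite closed slabs `[0, T_k]`.  This file
bridges the two, using only PROVED tree theorems:

* `isGlobalLerayHopf_floor`, `isSuitableWeakSolutionOn_floor`, `pressure_floor_lt_top`,
  `exists_isLocalLeraySolution_floor` — for a consistent family of Tao-class solutions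
  `(U n, P n)` on `[0, n + 1]` from one datum `u₀` (`ν > 0`), the floor-glued global classical
  solution `t ↦ U ⌊t⌋₊ t` of `IsTaoSolutionOn.global_of_nat` is a global Leray–Hopf solution
  (`IsLerayHopfOn.mono_holds` + `IsLerayHopfOn.congr_ae_slices` on each `[0, T]`), a suitable
  weak solution on the open slab `(0, ∞) × ℝ³` (classical solutions are suitable,
  `isSuitableWeakSolutionOn_of_contDiffOn`), its pressure is bounded on every `(0, T) × ℝ³`
  (hence `L^{3/2}_loc` up to `t = 0`), and therefore (the tree's bridge
  `IsGlobalLerayHopf.exists_forall_isLocalEnergySolutionOn_of_suitable_Ioi` +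
  `exists_isLocalLeraySolution_of_forall_isLocalEnergySolutionOn`, Kang–Miura–Tsai Lemma 3.3 /
  Lemarié-Rieusset Thm. 14.8 Step 3) there is a local Leray solution `(V, Π) ∈ 𝒩(u₀)` with
  `V t = U ⌊t⌋₊ t` for every `t > 0`;
* `exists_global_localLeray_of_noSwirl` — **for a Tao-class solution `(u, p)` on `[0, T]`
  (`ν = 1`) from an axisymmetric swirl-free datum `u₀`**: a global classical solution `W` on
  `[0, ∞) × ℝ³` with `W 0 = u₀`, `W = u` on `[0, T)`, axisymmetric and swirl-free at every
  `t ≥ 0` (Ladyzhenskaya / Ukhovskii–Yudovich global regularity in the tree's form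
  `exists_isTaoSolutionOn_of_noSwirl` fed with the discharged `tao2011_smooth_local_existence_holds`
  and `axisymmetricNoSwirl_enstrophy_apriori_holds`; symmetry by `IsTaoSolutionOn.isAxisymmetric`
  / `.hasNoSwirl`; agreement by Prodi–Serrin uniqueness `IsTaoSolutionOn.eq_of_isTaoSolutionOn`),
  together with a local Leray solution `(V, Π) ∈ 𝒩(u₀)` equal to `W` at every positive time,
  and the datum facts `u₀ ∈ L² ∩ L³`, weakly divergence free.

WHAT THIS IS NOT: not NS regularity or blow-up — bookkeeping over proved tree theorems (the
swirl-free class IS globally regular; nothing here touches data with swirl); the crux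
`L3CascadeJaw` is untouched; no crux claim.
-/

noncomputable section

open MeasureTheory Set Function Filter Topology TopologicalSpace Metric
open scoped ENNReal NNReal ContDiff RealInnerProductSpace

namespace Summit.NavierStokesRegularity.NavierStokesRegularity.Theorems.L3TimeExponentPincerGlobalNoSwirlLeray

open Literature.Analysis.FluidPDE


/-! ### The floor-glued global solution of a consistent family of Tao-class solutions -/

section Floor

variable {ν : ℝ} {u₀ : (EuclideanSpace ℝ (Fin 3)) → (EuclideanSpace ℝ (Fin 3))} {U : ℕ → ℝ → (EuclideanSpace ℝ (Fin 3)) → (EuclideanSpace ℝ (Fin 3))} {P : ℕ → ℝ → (EuclideanSpace ℝ (Fin 3)) → ℝ}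

/-- On the one-sided open time set `(0, ∞)` the time derivative within `(0, ∞)` is the
two-sided one. -/
theorem timeDerivWithin_Ioi_eq {w : ℝ → (EuclideanSpace ℝ (Fin 3)) → (EuclideanSpace ℝ (Fin 3))} {t : ℝ} (ht : t ∈ Ioi (0 : ℝ)) (x : (EuclideanSpace ℝ (Fin 3))) :
    timeDerivWithin (Ioi 0) w t x = timeDeriv w t x := by
  simp only [timeDerivWithin, timeDeriv]
  exact derivWithin_of_isOpen isOpen_Ioi ht

/-- The underlying set of the open slab `(0, ∞) × ℝ³`. -/
theorem coe_slab_Ioi : ((slab (EuclideanSpace ℝ (Fin 3)) (Ioi 0) isOpen_Ioi : Opens (ℝ × (EuclideanSpace ℝ (Fin 3)))) :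
    Set (ℝ × (EuclideanSpace ℝ (Fin 3)))) = Ioi (0 : ℝ) ×ˢ (univ : Set (EuclideanSpace ℝ (Fin 3))) := rfl

/-- The floor-glued velocity is jointly continuous on `[0, ∞) × ℝ³`, hence measurable on every
strip `(0, T) × ℝ³`. -/
theorem aestronglyMeasurable_floor (hU : ∀ n : ℕ, IsTaoSolutionOn ((n : ℝ) + 1) ν u₀ (U n) (P n))
    (hν : 0 < ν) (T : ℝ) :
    AEStronglyMeasurable (uncurry fun t => U ⌊t⌋₊ t) (volume.restrict (Ioo 0 T ×ˢ univ)) := by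
  have hcl := (IsTaoSolutionOn.global_of_nat hU hν).1
  exact (hcl.smooth_velocity.continuousOn.mono
    (prod_mono (Ioo_subset_Icc_self.trans (Icc_subset_Ici_self)) Subset.rfl)).aestronglyMeasurable
    (measurableSet_Ioo.prod MeasurableSet.univ)

/-- **The floor-glued solution is a global Leray–Hopf weak solution** from `u₀`: on `[0, T]`,
`T < N + 1`, it coincides slice-wise with the Tao-class solution `U N`, which is Leray–Hopf on
`[0, N + 1]` (`IsTaoSolutionOn.isLerayHopfOn`), hence on `[0, T]` (`IsLerayHopfOn.mono_holds`),
and Leray–Hopf solutions may be modified slice-wise a.e. (`IsLerayHopfOn.congr_ae_slices`). -/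
theorem isGlobalLerayHopf_floor (hU : ∀ n : ℕ, IsTaoSolutionOn ((n : ℝ) + 1) ν u₀ (U n) (P n))
    (hν : 0 < ν) : IsGlobalLerayHopf ν 0 u₀ (fun t => U ⌊t⌋₊ t) := by
  intro T hT
  set N : ℕ := ⌊T⌋₊ with hN
  have hNpos : (0 : ℝ) < (N : ℝ) + 1 := by positivity
  have hTN : T < (N : ℝ) + 1 := Nat.lt_floor_add_one T
  have hLH : IsLerayHopfOn ((N : ℝ) + 1) ν 0 u₀ (U N) := (hU N).isLerayHopfOn hNpos
  have hLHT : IsLerayHopfOn T ν 0 u₀ (U N) := IsLerayHopfOn.mono_holds hLH hTN.le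
  refine hLHT.congr_ae_slices hT (aestronglyMeasurable_floor hU hν T) fun t ht => ?_
  have h := (IsTaoSolutionOn.floor_eq hU hν N ⟨ht.1, ht.2.trans_lt hTN⟩).1
  exact Filter.EventuallyEq.of_eq h

/-- **The floor-glued solution is a suitable weak solution on the open slab `(0, ∞) × ℝ³`**
(classical solutions are suitable, CKN 1982 §2 with equality in (2.5):
`isSuitableWeakSolutionOn_of_contDiffOn`). -/
theorem isSuitableWeakSolutionOn_floor
    (hU : ∀ n : ℕ, IsTaoSolutionOn ((n : ℝ) + 1) ν u₀ (U n) (P n)) (hν : 0 < ν) :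
    IsSuitableWeakSolutionOn (slab (EuclideanSpace ℝ (Fin 3)) (Ioi 0) isOpen_Ioi) ν 0
      (fun t => U ⌊t⌋₊ t) (fun t => P ⌊t⌋₊ t) := by
  have hcl := (IsTaoSolutionOn.global_of_nat hU hν).1
  have hclI : IsClassicalNSSolutionOn (Ioi 0) ν 0 (fun t => U ⌊t⌋₊ t) (fun t => P ⌊t⌋₊ t) :=
    hcl.mono Ioi_subset_Ici_self isOpen_Ioi.uniqueDiffOn
  refine isSuitableWeakSolutionOn_of_contDiffOn isOpen_Ioi (by rw [coe_slab_Ioi])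
    (hclI.smooth_velocity.of_le (by norm_cast)) (hclI.smooth_pressure.of_le (by norm_cast))
    continuousOn_const (fun t ht x => ?_) hclI.divFree
  rw [← timeDerivWithin_Ioi_eq ht x]
  exact hclI.momentum t ht x

/-- **The floor-glued pressure is in `L^{3/2}((0, T) × K)`** for every `T` and compact `K`:
on `(0, T)`, `T < N + 1`, it is the pressure `P N` of a Tao-class solution, which is bounded on
`[0, N + 1] × ℝ³` (`IsTaoSolutionOn.exists_bound_pressure`). -/
theorem pressure_floor_lt_top (hU : ∀ n : ℕ, IsTaoSolutionOn ((n : ℝ) + 1) ν u₀ (U n) (P n))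
    (hν : 0 < ν) (T : ℝ) (K : Set (EuclideanSpace ℝ (Fin 3))) (hK : IsCompact K) :
    ∫⁻ z in Ioo 0 T ×ˢ K, ‖(fun t => P ⌊t⌋₊ t) z.1 z.2‖ₑ ^ (3 / 2 : ℝ) < ⊤ := by
  set N : ℕ := ⌊T⌋₊ with hN
  have hTN : T < (N : ℝ) + 1 := Nat.lt_floor_add_one T
  obtain ⟨B, hB0, hB⟩ := (hU N).exists_bound_pressure
  have hmeas : MeasurableSet (Ioo (0 : ℝ) T ×ˢ K) := measurableSet_Ioo.prod hK.measurableSet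
  have hbound : ∀ z ∈ Ioo (0 : ℝ) T ×ˢ K,
      ‖(fun t => P ⌊t⌋₊ t) z.1 z.2‖ₑ ^ (3 / 2 : ℝ) ≤ ENNReal.ofReal B ^ (3 / 2 : ℝ) := by
    rintro ⟨t, x⟩ ⟨ht, -⟩
    have heq : P ⌊t⌋₊ t = P N t := (IsTaoSolutionOn.floor_eq hU hν N ⟨ht.1.le, ht.2.trans hTN⟩).2
    refine ENNReal.rpow_le_rpow ?_ (by norm_num)
    show ‖P ⌊t⌋₊ t x‖ₑ ≤ ENNReal.ofReal B
    rw [heq, ← ofReal_norm]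
    exact ENNReal.ofReal_le_ofReal (hB t ⟨ht.1.le, (ht.2.trans hTN).le⟩ x)
  calc ∫⁻ z in Ioo 0 T ×ˢ K, ‖(fun t => P ⌊t⌋₊ t) z.1 z.2‖ₑ ^ (3 / 2 : ℝ)
      ≤ ∫⁻ _ in Ioo 0 T ×ˢ K, ENNReal.ofReal B ^ (3 / 2 : ℝ) := setLIntegral_mono' hmeas hbound
    _ = ENNReal.ofReal B ^ (3 / 2 : ℝ) * volume (Ioo (0 : ℝ) T ×ˢ K) := setLIntegral_const _ _
    _ < ⊤ := by
        refine ENNReal.mul_lt_top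
          (ENNReal.rpow_lt_top_of_nonneg (by norm_num : (0 : ℝ) ≤ 3 / 2) ENNReal.ofReal_ne_top) ?_
        rw [Measure.volume_eq_prod, Measure.prod_prod]
        exact ENNReal.mul_lt_top measure_Ioo_lt_top hK.measure_lt_top

/-- The datum of a family of Tao-class solutions is square integrable. -/
theorem memLp_two_datum (hU : ∀ n : ℕ, IsTaoSolutionOn ((n : ℝ) + 1) ν u₀ (U n) (P n)) :
    MemLp u₀ 2 volume := by
  have h := (hU 0).continuousL2.1 0 ⟨le_rfl, by positivity⟩
  rwa [(hU 0).initial] at h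

/-- **The floor-glued global classical solution is a local Leray solution up to modification
at `t = 0`**: there is `(V, Π) ∈ 𝒩(u₀)` (`IsLocalLeraySolution ν u₀ V Π`) with `V t = U ⌊t⌋₊ t`
for every `t > 0` (the tree's bridge from global Leray–Hopf solutions with a suitable pressure
to local energy solutions on every strip, Kang–Miura–Tsai Lemma 3.3, and the tower lemma,
Lemarié-Rieusset 2016 Thm. 14.8 Step 3). -/
theorem exists_isLocalLeraySolution_floor
    (hU : ∀ n : ℕ, IsTaoSolutionOn ((n : ℝ) + 1) ν u₀ (U n) (P n)) (hν : 0 < ν) :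
    ∃ (V : ℝ → (EuclideanSpace ℝ (Fin 3)) → (EuclideanSpace ℝ (Fin 3))) (Pv : ℝ → (EuclideanSpace ℝ (Fin 3)) → ℝ), IsLocalLeraySolution ν u₀ V Pv ∧
      ∀ t : ℝ, 0 < t → V t = U ⌊t⌋₊ t := by
  obtain ⟨v, hv, hloc⟩ :=
    (isGlobalLerayHopf_floor hU hν).exists_forall_isLocalEnergySolutionOn_of_suitable_Ioi hν
      (memLp_two_datum hU) (isSuitableWeakSolutionOn_floor hU hν)
      (fun T _ K hK => pressure_floor_lt_top hU hν T K hK)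
  obtain ⟨V, Pv, hV, hagree⟩ := exists_isLocalLeraySolution_of_forall_isLocalEnergySolutionOn hloc
  exact ⟨V, Pv, hV, fun t ht => by rw [(hagree t ht).1, hv t ht]⟩

end Floor

/-! ### Swirl-free Tao-class solutions: global extension and the local Leray solution -/

/-- **A swirl-free Tao-class solution extends to a global classical solution which is a local
Leray solution.**  Let `(u, p)` be a Tao-class solution (`ν = 1`) on `[0, T]`, `T > 0`, from an
axisymmetric swirl-free datum `u₀`.  Then there are a global classical solution `(W, Q)` of the
unforced unit-viscosity Navier–Stokes system on `[0, ∞) × ℝ³` with `W 0 = u₀`, `W t = u t` for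
`t ∈ [0, T)`, `W t` axisymmetric and swirl-free for every `t ≥ 0`, and a local Leray solution
`(V, Π) ∈ 𝒩(u₀)` (`IsLocalLeraySolution 1 u₀ V Π`) with `V t = W t` for every `t > 0`. -/
theorem exists_global_localLeray_of_noSwirl {T : ℝ} (hT : 0 < T) {u₀ : (EuclideanSpace ℝ (Fin 3)) → (EuclideanSpace ℝ (Fin 3))}
    {u : ℝ → (EuclideanSpace ℝ (Fin 3)) → (EuclideanSpace ℝ (Fin 3))} {p : ℝ → (EuclideanSpace ℝ (Fin 3)) → ℝ} (h : IsTaoSolutionOn T 1 u₀ u p)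
    (hax : IsAxisymmetric u₀) (hns : HasNoSwirl u₀) :
    ∃ (W : ℝ → (EuclideanSpace ℝ (Fin 3)) → (EuclideanSpace ℝ (Fin 3))) (Q : ℝ → (EuclideanSpace ℝ (Fin 3)) → ℝ) (V : ℝ → (EuclideanSpace ℝ (Fin 3)) → (EuclideanSpace ℝ (Fin 3))) (Pv : ℝ → (EuclideanSpace ℝ (Fin 3)) → ℝ),
      IsClassicalNSSolutionOn (Ici 0) 1 0 W Q ∧ W 0 = u₀ ∧ (∀ t ∈ Ico 0 T, W t = u t) ∧
      (∀ t, 0 ≤ t → IsAxisymmetric (W t) ∧ HasNoSwirl (W t)) ∧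
      IsLocalLeraySolution 1 u₀ V Pv ∧ (∀ t, 0 < t → V t = W t) := by
  -- the datum is smooth, divergence free and `H^∞`
  obtain ⟨hsm, hdiv, hH⟩ := h.slice ⟨le_rfl, hT.le⟩
  rw [h.initial] at hsm hdiv hH
  -- Tao-class solutions on every `[0, n + 1]` (Ladyzhenskaya / Ukhovskii–Yudovich)
  have hex : ∀ n : ℕ, ∃ (v : ℝ → (EuclideanSpace ℝ (Fin 3)) → (EuclideanSpace ℝ (Fin 3))) (q : ℝ → (EuclideanSpace ℝ (Fin 3)) → ℝ),
      IsTaoSolutionOn ((n : ℝ) + 1) 1 u₀ v q := fun n =>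
    exists_isTaoSolutionOn_of_noSwirl tao2011_smooth_local_existence_holds
      axisymmetricNoSwirl_enstrophy_apriori_holds one_pos hsm hdiv hH hax hns (by positivity)
  choose U P hU using hex
  obtain ⟨hcl, h0, -⟩ := IsTaoSolutionOn.global_of_nat hU one_pos
  obtain ⟨V, Pv, hV, hVW⟩ := exists_isLocalLeraySolution_floor hU one_pos
  refine ⟨fun t => U ⌊t⌋₊ t, fun t => P ⌊t⌋₊ t, V, Pv, hcl, h0, fun t ht => ?_, fun t ht => ?_,
    hV, hVW⟩
  · -- agreement with `u` on `[0, T)`: both are Tao-class solutions from `u₀`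
    have hN : (0 : ℝ) < (⌊t⌋₊ : ℝ) + 1 := by positivity
    exact IsTaoSolutionOn.eq_of_isTaoSolutionOn (hU ⌊t⌋₊) h one_pos hN hT t
      ⟨ht.1, lt_min (Nat.lt_floor_add_one t) ht.2⟩
  · have hN : (0 : ℝ) < (⌊t⌋₊ : ℝ) + 1 := by positivity
    have htI : t ∈ Icc 0 ((⌊t⌋₊ : ℝ) + 1) := ⟨ht, (Nat.lt_floor_add_one t).le⟩
    exact ⟨(hU ⌊t⌋₊).isAxisymmetric one_pos hN hax t htI,
      (hU ⌊t⌋₊).hasNoSwirl one_pos hN hax hns t htI⟩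

/-- The datum of a Tao-class solution (`0 < T`) is in `L² ∩ L³` and weakly divergence free. -/
theorem datum_memLp_isWeaklyDivFree {T ν : ℝ} (hT : 0 < T) {u₀ : (EuclideanSpace ℝ (Fin 3)) → (EuclideanSpace ℝ (Fin 3))} {u : ℝ → (EuclideanSpace ℝ (Fin 3)) → (EuclideanSpace ℝ (Fin 3))}
    {p : ℝ → (EuclideanSpace ℝ (Fin 3)) → ℝ} (h : IsTaoSolutionOn T ν u₀ u p) :
    MemLp u₀ 2 volume ∧ MemLp u₀ 3 volume ∧ IsWeaklyDivFree u₀ := by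
  obtain ⟨hsm, hdiv, -⟩ := h.slice ⟨le_rfl, hT.le⟩
  rw [h.initial] at hsm hdiv
  have h2 := h.continuousL2.1 0 ⟨le_rfl, hT.le⟩
  rw [h.initial] at h2
  exact ⟨h2, h.memLp_three_initial hT.le,
    VectorCalculus.IsDivFree.isWeaklyDivFree_holds hdiv (hsm.of_le (by norm_cast))⟩

end Summit.NavierStokesRegularity.NavierStokesRegularity.Theorems.L3TimeExponentPincerGlobalNoSwirlLeray

end
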